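import Summits.CriticalPhenomena.Ising3D.Control2DL19BoxXData148
import Summits.CriticalPhenomena.Ising3D.Control2DL19BoxXData149
import Summits.CriticalPhenomena.Ising3D.Control2DL19BoxXData150
import HarnessLib

/-!
# Kernel replay of the RB-7 box certificate X (Λ = 19, E₀ = 48, box [197/200, 99/100]): GROUP-SUM BRIDGES (part A: spin 2 / g2, g3)
(cell `pub-ising3x`, seat controls-1 gen 25; KERNEL PATH for the 2D γ-certificates, Λ = 19 — CONTROL-ONLY)

HONEST FRAMING: lottery ticket; floor = tightest certified 3D Ising CFT bounds; no exact-solution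
claim without a proof. CONTROL-ONLY (`d = 2`, `Δ_σ = 1/8`; axiom set A2D′).

The cells module `Control2DL19BoxX` (KP7 g20 / KP10 g24) applies Bernstein leaves that were decided on the GROUP-SUM form
`phatboxXs<ℓ>g<i> = List.foldr zadd [] [grp…]` of a spin's cell polynomial (extra leaf files carry no import of the spin file) and
bridged each application inline by `show phatboxXs<ℓ> = phatboxXs<ℓ>g<i> from by decide +kernel`. Measured (controls-1 g25, farm):
ONE such bridge costs ≈ 55 s of kernel time at spin 2 (28 Nd-79 group literals), ≈ 20 s at spins 4/6, and every OCCURRENCE is checked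
anew (the same statement three times: 209 s), so the 28 occurrences of the cells module could not meet the gate's 600 s. The spin-2/4/6
bridges are therefore proved HERE, once, as named equalities of integer lists (pure `decide +kernel`, no mathematics), and
`Control2DL19BoxX` rewrites with them (its spin-0 bridge is a single local `have`). No facts, standard axioms only.
-/

namespace Summit.CriticalPhenomena.Ising3D.Control2D

set_option maxHeartbeats 0 in
set_option maxRecDepth 200000 in
/-- The spin literal `phatboxXs2` equals the group-sum form `phatboxXs2g2` (coefficientwise sum of its group literals, added in the kernel). [folklore] -/
theorem phatboxXs2_eq_g2 : phatboxXs2 = phatboxXs2g2 := by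
  decide +kernel

set_option maxHeartbeats 0 in
set_option maxRecDepth 200000 in
/-- The spin literal `phatboxXs2` equals the group-sum form `phatboxXs2g3` (coefficientwise sum of its group literals, added in the kernel). [folklore] -/
theorem phatboxXs2_eq_g3 : phatboxXs2 = phatboxXs2g3 := by
  decide +kernel

end Summit.CriticalPhenomena.Ising3D.Control2D
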